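import Summits.HodgeConjecture.HodgeConjecture.Theorems.AnchorTransportTargetIffHodgeConjecture
import Literature.AlgebraicGeometry.HodgeTheory.MiddleDimensionReductionHolds
import Literature.AlgebraicGeometry.HodgeTheory.LefschetzOneOne

/-!
# Route AnchorTransport — the target reduces to middle-dimensional classes on even-dimensional fibres
(helpers for item stmt-HodgeConjecture-1079)

`Target = VariationalHodge ∧ AnchorExistence` is graded by the pair `(n, p)` (relative dimension of
the family / dimension of the variety, and codimension of the class), and so is the Hodge
conjecture.  This file records, on the tree's real carriers:

* `anchorTransport_mem_algebraicClasses_of_graded` — the route's assembly ONE BIDEGREE AT A TIME: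
  variational Hodge for `(n, p)` and anchor existence for `(n, p)` give "every rational `(p,p)` class
  on every smooth projective `n`-fold is algebraic" (anchor, transport along the family, transport
  across the fibre iso by the proved support `IsoInvariance`);
* `anchorTransport_graded_of_mem_algebraicClasses` — conversely the Hodge conjecture in bidegree
  `(n, p)` gives both crux bodies in bidegree `(n, p)` (fibrewise / constant-family anchor);
* `anchorTransport_hodgeConjecture_of_middleDimension` — **the Hodge conjecture follows from the
  two cruxes restricted to families of EVEN relative dimension `2m` and classes of degree `2m`
  (`p = m`)**: by the graded assembly these give the middle-dimensional Hodge conjecture, and BFNP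
  Lemma 48 (`middleDimensionReduction_holds`, unconditional in the tree since de Rham's theorem
  `exists_deRhamIsoFamily_holds` landed: products with projective spaces below the middle, linear
  sections and weak Lefschetz above it) does the rest;
* `anchorTransport_target_iff_middleDimension` — hence **`Target` is equivalent to its own
  middle-dimensional case**: to run the anchor-transport programme it suffices to anchor and
  transport middle-degree Hodge classes on even-dimensional smooth projective families
  (`2 ≤ 2m`, the first open case being `(2,2)`-classes on fourfold families);
* `hodgeConjecture_iff_middleDimension` — the summit statement itself is equivalent to its
  middle-dimensional case (BFNP Lemma 48 read as an `iff`, unconditional);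
* `anchorTransport_target_iff_middleDimension_two_le` / `hodgeConjecture_iff_middleDimension_two_le`
  — granted Lefschetz's theorem on `(1,1)`-classes (the tree's named fact
  `lefschetzOneOne_rational`), the cases `m = 0` (`N⁰ H⁰ = H⁰`) and `m = 1` (curve classes on
  surfaces) are free, so `Target` (resp. the Hodge conjecture) is equivalent to its case
  `n = 2m ≥ 4`, `p = m`: fourfolds in codimension `2`, sixfolds in codimension `3`, ….

References: P. Brosnan, H. Fang, Z. Nie, G. Pearlstein, Invent. Math. 177 (2009), §6 Lemma 48;
F. Charles, C. Schnell, *Notes on absolute Hodge classes* (2014), §11.3.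
-/

noncomputable section

-- `Summit.HodgeConjecture.HodgeConjecture.Theorems` is the mandated namespace (single-problem summit:
-- Problem = Summit), which `linter.dupNamespace` flags on every declaration; the lakefile turns the
-- linter off tree-wide (weak option), restated here so stand-alone elaboration is warning-free too.
set_option linter.dupNamespace false

open CategoryTheory AlgebraicGeometry CategoryTheory.Limits
open Literature.AlgebraicGeometry Literature.AlgebraicGeometry.Motives
  Literature.AlgebraicGeometry.HodgeTheory Literature.AlgebraicTopology.SingularHomology

namespace Summit.HodgeConjecture.HodgeConjecture.Theorems

section Graded

variable {n p : ℕ}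

/-- **Graded assembly.** Variational Hodge in bidegree `(n, p)` (families of relative dimension
`n`, classes of degree `2p`) and anchor existence in bidegree `(n, p)` imply that every rational
`(p,p)` class on every smooth projective `n`-fold is algebraic: anchor `(f, s₁, s₀, e, A)`,
transport algebraicity from `s₀` to `s₁` along `f`, then across `e : X ≅ 𝒳_{s₁}` by the proved
support item `IsoInvariance`. (The route's deciding theorem `closes`, one bidegree at a time.)
[cite: CharlesSchnell2014Notes, §11.3 Prop. 11.3.5] -/
theorem anchorTransport_mem_algebraicClasses_of_graded
    (hV : ∀ ⦃𝒳 S : SchemeOver ℂ⦄ (f : 𝒳 ⟶ S), IsSmoothProjectiveFamily f n →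
      IrreducibleSpace S.left → Smooth S.hom → ∀ A : complexBetti 𝒳 (2 * p),
      (∀ s : ComplexPoints S, IsRationalClass (complexBetti.map (fiberι f s) (2 * p) A) ∧
        IsOfHodgeType n (fiberOver f s) (2 * p) p p (complexBetti.map (fiberι f s) (2 * p) A)) →
      (∃ s₀ : ComplexPoints S,
        complexBetti.map (fiberι f s₀) (2 * p) A ∈ algebraicClasses (fiberOver f s₀) p) →
      ∀ s : ComplexPoints S,
        complexBetti.map (fiberι f s) (2 * p) A ∈ algebraicClasses (fiberOver f s) p)
    (hAn : ∀ ⦃X : SchemeOver ℂ⦄, IsSmoothProjective n X → ∀ c : complexBetti X (2 * p),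
      IsRationalClass c → IsOfHodgeType n X (2 * p) p p c →
      ∃ (𝒳 S : SchemeOver ℂ) (f : 𝒳 ⟶ S) (s₁ s₀ : ComplexPoints S) (e : X ≅ fiberOver f s₁)
        (A : complexBetti 𝒳 (2 * p)),
        IsSmoothProjectiveFamily f n ∧ IrreducibleSpace S.left ∧ Smooth S.hom ∧
        (∀ s : ComplexPoints S, IsRationalClass (complexBetti.map (fiberι f s) (2 * p) A) ∧
          IsOfHodgeType n (fiberOver f s) (2 * p) p p (complexBetti.map (fiberι f s) (2 * p) A)) ∧
        complexBetti.map e.hom (2 * p) (complexBetti.map (fiberι f s₁) (2 * p) A) = c ∧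
        complexBetti.map (fiberι f s₀) (2 * p) A ∈ algebraicClasses (fiberOver f s₀) p)
    ⦃X : SchemeOver ℂ⦄ (hX : IsSmoothProjective n X) (c : complexBetti X (2 * p))
    (hc : IsRationalClass c) (hpp : IsOfHodgeType n X (2 * p) p p c) :
    c ∈ algebraicClasses X p := by
  obtain ⟨𝒳, S, f, s₁, s₀, e, A, hf, hirr, hsm, hfib, hAc, hs₀⟩ := hAn hX c hc hpp
  -- transport algebraicity from the anchor fibre `s₀` to the fibre `s₁` (variational Hodge) …
  have h₁ := hV f hf hirr hsm A hfib ⟨s₀, hs₀⟩ s₁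
  -- … and across the isomorphism `e : X ≅ 𝒳_{s₁}` (proved support item `IsoInvariance`)
  have h₂ := Summit.HodgeConjecture.HodgeConjecture.Theses.AnchorTransport.IsoInvariance_holds e p _ h₁
  rwa [hAc] at h₂

/-- **Graded converse.** If every rational `(p,p)` class on every smooth projective `n`-fold is
algebraic, then variational Hodge holds in bidegree `(n, p)` (apply it on the fibre `𝒳_s`, smooth
projective of dimension `n`) and anchor existence holds in bidegree `(n, p)` (the constant family
`X ⟶ Spec ℂ` anchors an algebraic class, `anchorTransport_anchor_of_mem_algebraicClasses`).
[cite: CharlesSchnell2014Notes, §11.3 Cor. 11.3.6] -/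
theorem anchorTransport_graded_of_mem_algebraicClasses
    (h : ∀ ⦃X : SchemeOver ℂ⦄, IsSmoothProjective n X → ∀ c : complexBetti X (2 * p),
      IsRationalClass c → IsOfHodgeType n X (2 * p) p p c → c ∈ algebraicClasses X p) :
    (∀ ⦃𝒳 S : SchemeOver ℂ⦄ (f : 𝒳 ⟶ S), IsSmoothProjectiveFamily f n →
      IrreducibleSpace S.left → Smooth S.hom → ∀ A : complexBetti 𝒳 (2 * p),
      (∀ s : ComplexPoints S, IsRationalClass (complexBetti.map (fiberι f s) (2 * p) A) ∧
        IsOfHodgeType n (fiberOver f s) (2 * p) p p (complexBetti.map (fiberι f s) (2 * p) A)) →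
      (∃ s₀ : ComplexPoints S,
        complexBetti.map (fiberι f s₀) (2 * p) A ∈ algebraicClasses (fiberOver f s₀) p) →
      ∀ s : ComplexPoints S,
        complexBetti.map (fiberι f s) (2 * p) A ∈ algebraicClasses (fiberOver f s) p) ∧
    (∀ ⦃X : SchemeOver ℂ⦄, IsSmoothProjective n X → ∀ c : complexBetti X (2 * p),
      IsRationalClass c → IsOfHodgeType n X (2 * p) p p c →
      ∃ (𝒳 S : SchemeOver ℂ) (f : 𝒳 ⟶ S) (s₁ s₀ : ComplexPoints S) (e : X ≅ fiberOver f s₁)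
        (A : complexBetti 𝒳 (2 * p)),
        IsSmoothProjectiveFamily f n ∧ IrreducibleSpace S.left ∧ Smooth S.hom ∧
        (∀ s : ComplexPoints S, IsRationalClass (complexBetti.map (fiberι f s) (2 * p) A) ∧
          IsOfHodgeType n (fiberOver f s) (2 * p) p p (complexBetti.map (fiberι f s) (2 * p) A)) ∧
        complexBetti.map e.hom (2 * p) (complexBetti.map (fiberι f s₁) (2 * p) A) = c ∧
        complexBetti.map (fiberι f s₀) (2 * p) A ∈ algebraicClasses (fiberOver f s₀) p) :=
  ⟨fun _ _ _ hf _ _ _ hA _ s ↦ h (hf.isSmoothProjective s) _ (hA s).1 (hA s).2,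
    fun _ hX c hc hpp ↦ anchorTransport_anchor_of_mem_algebraicClasses hX p c hc hpp (h hX c hc hpp)⟩

end Graded

section MiddleDimension

/-- **The Hodge conjecture from the two cruxes in the middle dimension.** If variational Hodge
holds for smooth projective families of even relative dimension `2m` and classes of degree `2m`
(`p = m`), and every rational `(m,m)` class on a smooth projective `2m`-fold is anchored, then the
Hodge conjecture holds for every smooth projective complex variety in every codimension: the
graded assembly gives the middle-dimensional Hodge conjecture, and BFNP Lemma 48
(`middleDimensionReduction_holds`, unconditional) extends it to all bidegrees (Hodge models by
`nonempty_hodgeModel_holds`). [cite: BrosnanFangNiePearlstein2009, §6 Lemma 48] -/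
theorem anchorTransport_hodgeConjecture_of_middleDimension
    (hV : ∀ (m : ℕ) ⦃𝒳 S : SchemeOver ℂ⦄ (f : 𝒳 ⟶ S), IsSmoothProjectiveFamily f (2 * m) →
      IrreducibleSpace S.left → Smooth S.hom → ∀ A : complexBetti 𝒳 (2 * m),
      (∀ s : ComplexPoints S, IsRationalClass (complexBetti.map (fiberι f s) (2 * m) A) ∧
        IsOfHodgeType (2 * m) (fiberOver f s) (2 * m) m m
          (complexBetti.map (fiberι f s) (2 * m) A)) →
      (∃ s₀ : ComplexPoints S,
        complexBetti.map (fiberι f s₀) (2 * m) A ∈ algebraicClasses (fiberOver f s₀) m) →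
      ∀ s : ComplexPoints S,
        complexBetti.map (fiberι f s) (2 * m) A ∈ algebraicClasses (fiberOver f s) m)
    (hAn : ∀ (m : ℕ) ⦃X : SchemeOver ℂ⦄, IsSmoothProjective (2 * m) X →
      ∀ c : complexBetti X (2 * m), IsRationalClass c → IsOfHodgeType (2 * m) X (2 * m) m m c →
      ∃ (𝒳 S : SchemeOver ℂ) (f : 𝒳 ⟶ S) (s₁ s₀ : ComplexPoints S) (e : X ≅ fiberOver f s₁)
        (A : complexBetti 𝒳 (2 * m)),
        IsSmoothProjectiveFamily f (2 * m) ∧ IrreducibleSpace S.left ∧ Smooth S.hom ∧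
        (∀ s : ComplexPoints S, IsRationalClass (complexBetti.map (fiberι f s) (2 * m) A) ∧
          IsOfHodgeType (2 * m) (fiberOver f s) (2 * m) m m
            (complexBetti.map (fiberι f s) (2 * m) A)) ∧
        complexBetti.map e.hom (2 * m) (complexBetti.map (fiberι f s₁) (2 * m) A) = c ∧
        complexBetti.map (fiberι f s₀) (2 * m) A ∈ algebraicClasses (fiberOver f s₀) m) :
    _root_.HodgeConjecture :=
  fun _ _ hX ↦ hodgeConjectureFor_of_middleDimension_holds
    (fun m _ hY c hc hpp ↦ anchorTransport_mem_algebraicClasses_of_graded (hV m) (hAn m) hY c hc hpp)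
    hX

/-- **`Target` from its middle-dimensional case**: variational Hodge and anchor existence for
families of even relative dimension `2m` and classes of degree `2m` imply the full target
(all relative dimensions `n`, all codimensions `p`) — through the Hodge conjecture
(`anchorTransport_hodgeConjecture_of_middleDimension`) and `Target ↔ HodgeConjecture`
(`anchorTransport_target_of_hodgeConjecture`). [cite: BrosnanFangNiePearlstein2009, §6 Lemma 48] -/
theorem anchorTransport_target_of_middleDimension
    (hV : ∀ (m : ℕ) ⦃𝒳 S : SchemeOver ℂ⦄ (f : 𝒳 ⟶ S), IsSmoothProjectiveFamily f (2 * m) →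
      IrreducibleSpace S.left → Smooth S.hom → ∀ A : complexBetti 𝒳 (2 * m),
      (∀ s : ComplexPoints S, IsRationalClass (complexBetti.map (fiberι f s) (2 * m) A) ∧
        IsOfHodgeType (2 * m) (fiberOver f s) (2 * m) m m
          (complexBetti.map (fiberι f s) (2 * m) A)) →
      (∃ s₀ : ComplexPoints S,
        complexBetti.map (fiberι f s₀) (2 * m) A ∈ algebraicClasses (fiberOver f s₀) m) →
      ∀ s : ComplexPoints S,
        complexBetti.map (fiberι f s) (2 * m) A ∈ algebraicClasses (fiberOver f s) m)
    (hAn : ∀ (m : ℕ) ⦃X : SchemeOver ℂ⦄, IsSmoothProjective (2 * m) X →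
      ∀ c : complexBetti X (2 * m), IsRationalClass c → IsOfHodgeType (2 * m) X (2 * m) m m c →
      ∃ (𝒳 S : SchemeOver ℂ) (f : 𝒳 ⟶ S) (s₁ s₀ : ComplexPoints S) (e : X ≅ fiberOver f s₁)
        (A : complexBetti 𝒳 (2 * m)),
        IsSmoothProjectiveFamily f (2 * m) ∧ IrreducibleSpace S.left ∧ Smooth S.hom ∧
        (∀ s : ComplexPoints S, IsRationalClass (complexBetti.map (fiberι f s) (2 * m) A) ∧
          IsOfHodgeType (2 * m) (fiberOver f s) (2 * m) m m
            (complexBetti.map (fiberι f s) (2 * m) A)) ∧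
        complexBetti.map e.hom (2 * m) (complexBetti.map (fiberι f s₁) (2 * m) A) = c ∧
        complexBetti.map (fiberι f s₀) (2 * m) A ∈ algebraicClasses (fiberOver f s₀) m) :
    Summit.HodgeConjecture.HodgeConjecture.Theses.AnchorTransport.Target :=
  anchorTransport_target_of_hodgeConjecture (anchorTransport_hodgeConjecture_of_middleDimension hV hAn)

/-- **`Target` is equivalent to its middle-dimensional case** (the conjunction of the two crux
bodies specialised to `n = 2m`, `p = m`): forward by specialisation, backward by
`anchorTransport_target_of_middleDimension` (BFNP Lemma 48 + the graded assembly).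
[cite: BrosnanFangNiePearlstein2009, §6 Lemma 48] -/
theorem anchorTransport_target_iff_middleDimension :
    Summit.HodgeConjecture.HodgeConjecture.Theses.AnchorTransport.Target ↔
    (∀ (m : ℕ) ⦃𝒳 S : SchemeOver ℂ⦄ (f : 𝒳 ⟶ S), IsSmoothProjectiveFamily f (2 * m) →
      IrreducibleSpace S.left → Smooth S.hom → ∀ A : complexBetti 𝒳 (2 * m),
      (∀ s : ComplexPoints S, IsRationalClass (complexBetti.map (fiberι f s) (2 * m) A) ∧
        IsOfHodgeType (2 * m) (fiberOver f s) (2 * m) m m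
          (complexBetti.map (fiberι f s) (2 * m) A)) →
      (∃ s₀ : ComplexPoints S,
        complexBetti.map (fiberι f s₀) (2 * m) A ∈ algebraicClasses (fiberOver f s₀) m) →
      ∀ s : ComplexPoints S,
        complexBetti.map (fiberι f s) (2 * m) A ∈ algebraicClasses (fiberOver f s) m) ∧
    (∀ (m : ℕ) ⦃X : SchemeOver ℂ⦄, IsSmoothProjective (2 * m) X →
      ∀ c : complexBetti X (2 * m), IsRationalClass c → IsOfHodgeType (2 * m) X (2 * m) m m c →
      ∃ (𝒳 S : SchemeOver ℂ) (f : 𝒳 ⟶ S) (s₁ s₀ : ComplexPoints S) (e : X ≅ fiberOver f s₁)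
        (A : complexBetti 𝒳 (2 * m)),
        IsSmoothProjectiveFamily f (2 * m) ∧ IrreducibleSpace S.left ∧ Smooth S.hom ∧
        (∀ s : ComplexPoints S, IsRationalClass (complexBetti.map (fiberι f s) (2 * m) A) ∧
          IsOfHodgeType (2 * m) (fiberOver f s) (2 * m) m m
            (complexBetti.map (fiberι f s) (2 * m) A)) ∧
        complexBetti.map e.hom (2 * m) (complexBetti.map (fiberι f s₁) (2 * m) A) = c ∧
        complexBetti.map (fiberι f s₀) (2 * m) A ∈ algebraicClasses (fiberOver f s₀) m) :=
  ⟨fun h ↦ ⟨fun m _ _ f hf hirr hsm ↦ h.1 f hf hirr hsm m, fun m _ hX ↦ h.2 hX m⟩,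
    fun h ↦ anchorTransport_target_of_middleDimension h.1 h.2⟩

/-- **The Hodge conjecture is equivalent to its middle-dimensional case** (BFNP Lemma 48 as an
`iff`, unconditional in the tree): every rational `(p,p)` class on every smooth projective complex
variety is algebraic iff every rational `(m,m)` class on every smooth projective `2m`-fold is.
[cite: BrosnanFangNiePearlstein2009, §6 Lemma 48] -/
theorem hodgeConjecture_iff_middleDimension :
    _root_.HodgeConjecture ↔
    ∀ (m : ℕ) ⦃X : SchemeOver ℂ⦄, IsSmoothProjective (2 * m) X →
      ∀ c : complexBetti X (2 * m), IsRationalClass c → IsOfHodgeType (2 * m) X (2 * m) m m c →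
        c ∈ algebraicClasses X m :=
  ⟨fun h m _ hX c hc hpp ↦ (h hX).2 m c hc hpp,
    fun h _ _ hX ↦ hodgeConjectureFor_of_middleDimension_holds (fun m _ hY ↦ h m hY) hX⟩

end MiddleDimension

section LefschetzFloor

/-- **The Hodge conjecture from the two cruxes in the middle dimension `2m ≥ 4`, granted Lefschetz
`(1,1)`.** As `anchorTransport_hodgeConjecture_of_middleDimension`, the bidegrees `(0, 0)`
(`algebraicClasses X 0 = ⊤`) and `(2, 1)` (rational `(1,1)` classes on surfaces: the named fact
`lefschetzOneOne_rational`, Voisin I Thm. 11.30) being free.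
[cite: BrosnanFangNiePearlstein2009, §6 Lemma 48] [cite: VoisinHodgeI2002, Thm. 11.30 and §11.3.2] -/
theorem anchorTransport_hodgeConjecture_of_middleDimension_two_le (hL : lefschetzOneOne_rational)
    (hV : ∀ (m : ℕ), 2 ≤ m → ∀ ⦃𝒳 S : SchemeOver ℂ⦄ (f : 𝒳 ⟶ S), IsSmoothProjectiveFamily f (2 * m) →
      IrreducibleSpace S.left → Smooth S.hom → ∀ A : complexBetti 𝒳 (2 * m),
      (∀ s : ComplexPoints S, IsRationalClass (complexBetti.map (fiberι f s) (2 * m) A) ∧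
        IsOfHodgeType (2 * m) (fiberOver f s) (2 * m) m m
          (complexBetti.map (fiberι f s) (2 * m) A)) →
      (∃ s₀ : ComplexPoints S,
        complexBetti.map (fiberι f s₀) (2 * m) A ∈ algebraicClasses (fiberOver f s₀) m) →
      ∀ s : ComplexPoints S,
        complexBetti.map (fiberι f s) (2 * m) A ∈ algebraicClasses (fiberOver f s) m)
    (hAn : ∀ (m : ℕ), 2 ≤ m → ∀ ⦃X : SchemeOver ℂ⦄, IsSmoothProjective (2 * m) X →
      ∀ c : complexBetti X (2 * m), IsRationalClass c → IsOfHodgeType (2 * m) X (2 * m) m m c →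
      ∃ (𝒳 S : SchemeOver ℂ) (f : 𝒳 ⟶ S) (s₁ s₀ : ComplexPoints S) (e : X ≅ fiberOver f s₁)
        (A : complexBetti 𝒳 (2 * m)),
        IsSmoothProjectiveFamily f (2 * m) ∧ IrreducibleSpace S.left ∧ Smooth S.hom ∧
        (∀ s : ComplexPoints S, IsRationalClass (complexBetti.map (fiberι f s) (2 * m) A) ∧
          IsOfHodgeType (2 * m) (fiberOver f s) (2 * m) m m
            (complexBetti.map (fiberι f s) (2 * m) A)) ∧
        complexBetti.map e.hom (2 * m) (complexBetti.map (fiberι f s₁) (2 * m) A) = c ∧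
        complexBetti.map (fiberι f s₀) (2 * m) A ∈ algebraicClasses (fiberOver f s₀) m) :
    _root_.HodgeConjecture := by
  refine fun _ _ hX ↦ hodgeConjectureFor_of_middleDimension_holds (fun m Y hY c hc hpp ↦ ?_) hX
  obtain hm | hm := Nat.lt_or_ge m 2
  · interval_cases m
    · rw [algebraicClasses_zero]
      exact Submodule.mem_top
    · exact hL hY c hc hpp
  · exact anchorTransport_mem_algebraicClasses_of_graded (hV m hm) (hAn m hm) hY c hc hpp

/-- **Granted Lefschetz `(1,1)`, `Target` is equivalent to its case `n = 2m ≥ 4`, `p = m`**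
(variational Hodge and anchor existence for families of even relative dimension `2m ≥ 4` and
classes of the middle degree `2m`; the first instance is `(2,2)`-classes on fourfold families).
Forward by specialisation; backward by `anchorTransport_hodgeConjecture_of_middleDimension_two_le`
and `Target ↔ HodgeConjecture`. [cite: BrosnanFangNiePearlstein2009, §6 Lemma 48]
[cite: VoisinHodgeI2002, Thm. 11.30 and §11.3.2] -/
theorem anchorTransport_target_iff_middleDimension_two_le (hL : lefschetzOneOne_rational) :
    Summit.HodgeConjecture.HodgeConjecture.Theses.AnchorTransport.Target ↔
    (∀ (m : ℕ), 2 ≤ m → ∀ ⦃𝒳 S : SchemeOver ℂ⦄ (f : 𝒳 ⟶ S), IsSmoothProjectiveFamily f (2 * m) →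
      IrreducibleSpace S.left → Smooth S.hom → ∀ A : complexBetti 𝒳 (2 * m),
      (∀ s : ComplexPoints S, IsRationalClass (complexBetti.map (fiberι f s) (2 * m) A) ∧
        IsOfHodgeType (2 * m) (fiberOver f s) (2 * m) m m
          (complexBetti.map (fiberι f s) (2 * m) A)) →
      (∃ s₀ : ComplexPoints S,
        complexBetti.map (fiberι f s₀) (2 * m) A ∈ algebraicClasses (fiberOver f s₀) m) →
      ∀ s : ComplexPoints S,
        complexBetti.map (fiberι f s) (2 * m) A ∈ algebraicClasses (fiberOver f s) m) ∧
    (∀ (m : ℕ), 2 ≤ m → ∀ ⦃X : SchemeOver ℂ⦄, IsSmoothProjective (2 * m) X →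
      ∀ c : complexBetti X (2 * m), IsRationalClass c → IsOfHodgeType (2 * m) X (2 * m) m m c →
      ∃ (𝒳 S : SchemeOver ℂ) (f : 𝒳 ⟶ S) (s₁ s₀ : ComplexPoints S) (e : X ≅ fiberOver f s₁)
        (A : complexBetti 𝒳 (2 * m)),
        IsSmoothProjectiveFamily f (2 * m) ∧ IrreducibleSpace S.left ∧ Smooth S.hom ∧
        (∀ s : ComplexPoints S, IsRationalClass (complexBetti.map (fiberι f s) (2 * m) A) ∧
          IsOfHodgeType (2 * m) (fiberOver f s) (2 * m) m m
            (complexBetti.map (fiberι f s) (2 * m) A)) ∧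
        complexBetti.map e.hom (2 * m) (complexBetti.map (fiberι f s₁) (2 * m) A) = c ∧
        complexBetti.map (fiberι f s₀) (2 * m) A ∈ algebraicClasses (fiberOver f s₀) m) :=
  ⟨fun h ↦ ⟨fun m _ _ _ f hf hirr hsm ↦ h.1 f hf hirr hsm m, fun m _ _ hX ↦ h.2 hX m⟩,
    fun h ↦ anchorTransport_target_of_hodgeConjecture
      (anchorTransport_hodgeConjecture_of_middleDimension_two_le hL h.1 h.2)⟩

/-- **Granted Lefschetz `(1,1)`, the Hodge conjecture is equivalent to its case `dim X = 2m ≥ 4`,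
`p = m`** (rational `(m,m)` classes on smooth projective `2m`-folds, `m ≥ 2`): BFNP Lemma 48 with
the free bidegrees `(0,0)` and `(2,1)`. [cite: BrosnanFangNiePearlstein2009, §6 Lemma 48]
[cite: VoisinHodgeI2002, Thm. 11.30 and §11.3.2] -/
theorem hodgeConjecture_iff_middleDimension_two_le (hL : lefschetzOneOne_rational) :
    _root_.HodgeConjecture ↔
    ∀ (m : ℕ), 2 ≤ m → ∀ ⦃X : SchemeOver ℂ⦄, IsSmoothProjective (2 * m) X →
      ∀ c : complexBetti X (2 * m), IsRationalClass c → IsOfHodgeType (2 * m) X (2 * m) m m c →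
        c ∈ algebraicClasses X m := by
  refine ⟨fun h m _ _ hX c hc hpp ↦ (h hX).2 m c hc hpp, fun h _ _ hX ↦
    hodgeConjectureFor_of_middleDimension_holds (fun m Y hY c hc hpp ↦ ?_) hX⟩
  obtain hm | hm := Nat.lt_or_ge m 2
  · interval_cases m
    · rw [algebraicClasses_zero]
      exact Submodule.mem_top
    · exact hL hY c hc hpp
  · exact h m hm hY c hc hpp

end LefschetzFloor

end Summit.HodgeConjecture.HodgeConjecture.Theorems

end
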